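import Summits.QuantumFields.YangMills.Theorems.UnitScaleTiltProp7CoarseFineKernelRows
import HarnessLib

/-!
# Route `UnitScaleTilt`, crux K1 «MinimiserStabilityRegPr» (stmt-QuantumFields-19200), EX face — K137 STOREY, road (K3) of LOCATE-K137, FILE (K3-door):
# **THE `Q_k†`-COMPOSITION DOOR FOR THE EX ROWS `h137kπ` ∕ `h137kΔ`** — the pointwise kernel row of the (137) letter `Q_k†((Q_kGQ_k†)⁻¹ ·) − Q_k†(a ·)` (coarse column → fine row)
# from ONE displayed coarse-entry row of the convention-free composite `(Q_kGQ_k†)⁻¹v − a•v` (= `(Q_kΔ′⁻¹Q_k†)⁻¹` by Woodbury), AT THE SAME RATE, by the tube row of `Q_k(U₀)†`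

Cell `ym3-torus` (HUMAN RULING D-0037; rung R3 = SU(2) YM₃ on T³ — NOT d = 4, NOT infinite volume, NOT a mass gap, NOT Clay).  Width seat `ym3-torus-px10` (gen 13; FREE px);
★`ym-ust-19200-p1` g27 CHAIR WORD №25 (3) «(K3) `Qk†`-composition door: GO — yours»; LOCATE `HOME/ym3-torus-px10/g13/LOCATE-K3-QKDAGGER-DOOR-px10g13.md` (19200 evidence #48).
THEOREMS ONLY (0 `def`, 0 `sorry`, default heartbeats); `--supports stmt-QuantumFields-19200 --as helper`; count-neutral.  Part 1 = ✓`…Prop7CoarseFineKernelRows` (the abstract Schur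
composition and the tube rows of `Q_k`, `Q_k†`).

THE ROWS (EX display S47 ✓`Prop7StubEXOfChartPiecesTwS47` ll.232–262; consumers ✓`Prop7Op137OfKernelRows.h137_of_kernel137_family_slot` ∕ `h137π_…` ∕ `h137Δ_…`).  `h137kπ` ∕ `h137kΔ` :=
`‖toL2⁻¹(Q_k(U₀)†((Q_kGQ_k†)⁻¹_{SLOT}(toL2B(δ_y ⊗ Z))) − Q_k(U₀)†(a•toL2B(δ_y ⊗ Z)))(b)‖ ≤ CK·e^{−δK·tdist(B_{K−n}(b), ŷ)}·‖Z‖`, SLOT = `Δ_πᴾ` ∕ `Δ^η + T_Jᴾ`; print [B11] (137) «Δ_πH = Q*(QGQ*)⁻¹B − Q*aB»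
over [B9] (3.132) «|(QGQ*)⁻¹(y,y′)| ≤ O(1)(Lʲη)⁻²(L^{j′}η)^{−d}e^{−δ₁d(y,y′)}» — print DEFERS the analysis of `(QGQ*)⁻¹` to [Balaban1984PropagatorsII] §2; this file does NOT supply it: the coarse
entry row stays DISPLAYED (`hKent`), to be discharged by the (K1)+(K2) lineage (px12 ✓p767189∕✓p767561∕✓p767718, px13 (K1b-a), px16, px21) through px12's
✓`Prop7KinvConjugateDecay.norm_symm_Kinv_single_le_of_conj_accretive` with px12 g13's block-distance weights.
THE DISPLAYED LETTER (coarse → coarse; `ŷ := siteShift (sites_eq F n K h) y.src` on the coarse torus `Site (F.P K) (K−n)`):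
  `hKent : ∀ y Z y′, ‖toL2B⁻¹((Q_kGQ_k†)⁻¹_{Δx}(toL2B(δ_y ⊗ Z)) − a•toL2B(δ_y ⊗ Z))(y′)‖ ≤ C_K·e^{−δ_K·tdist(ŷ′, ŷ)}·‖Z‖`
— the row of the COMPOSITE `K⁻¹v − a•v` (convention-free like the (137) letter itself: in the display's weights `K⁻¹ = KinvT` carries `(c₀∕cB)·ℓ³` relative to print, and so does the
coupling `a L i ≥ a₀(c₀∕cB)ℓ³`; the family edition therefore writes `C_K := CK L·((c₀ L∕cB L)·ℓ³)` with `CK L` K-free).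
THE ARGUMENT.  `Q_k†(K⁻¹v) − Q_k†(a•v) = (Q_k† ∘ (K⁻¹ − a•1))(v)`; part 1's ★`kernelRow_CF_comp_CC` with the tube row ★`kernelRow_adjoint_Qk_of_regPr` taken at the FREE rate `δ_K + 1`
(outer absorption, `ν = 1`, middle volume `3·(2·2)³ = 192` coarse bonds' worth of `e^{−tdist}`) keeps the rate `δ_K`: constant `2·5·(cB∕c₀)ℓ⁻³e^{δ_K+1}·C_K·192`; at the family's scaling
`C_K = CK L·(c₀∕cB)ℓ³` this is `1920·e^{δK L+1}·CK L` — K-FREE, L-only, as the EX display's `CKπ`∕`CKΔ : ℕ → ℝ` require.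
WHAT IS PROVED (ns `Summit.QuantumFields.YangMills.Theorems.Prop7Kernel137DoorOfKinvEntry`).
* §1 ★★★ `kernel137_of_kinvEntry` — MEMBER, GENERIC SLOT `Δx`: `RegPr F n K ε₀ U₀` + `10¹⁰L⁶ε₀ ≤ 1` + `10¹²L³ε₀ ≤ 1` + `hKent` (C_K ≥ 0, δ_K > 0) ⟹ the `h137k` member text with
  constant `1920·(cB∕c₀)·ℓ⁻³·e^{δ_K+1}·C_K` at rate `δ_K`.
* §2 ★★★ `kernel137_family_of_kinvEntry` — Idx EDITION, GENERIC SLOT `Δx L i` AND GENERIC THREAD `Λ L i U₀` (the S47 face instantiates `Λ` := the `Lift L i U₀` antecedent of record, ✓`h137_of_…`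
  instantiates `Λ := True`): displayed family letter `hKent` under `RegPr ρ U₀ → ρ ≤ α L → Λ L i U₀ →` with constant `CK L·((c₀ L∕cB L)·((L:ℝ)^(K−n))^3)` ⟹ the S47 row text under the same thread with
  the L-ONLY constant `1920·exp(δK L + 1)·CK L` and rate `δK L` (windows `10¹⁰L⁶α L ≤ 1`, `10¹²L³α L ≤ 1` displayed on the cap `α`).
* §4 (v1.1) `kinvEntry_of_kinvRow` (the coupling term is diagonal: `hKent ⟸ hKinv` with `C_K + |a|`), ★★★`kernel137_of_kinvRow` (member), ★★★`kernel137_family_of_kinvRow` (Idx; displayed upper bound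
  `|a L i| ≤ A L·((c₀∕cB)ℓ³)` on the pinned coupling; constant `1920·e^{δK L+1}·(CK L + A L)`) — ONE coarse-entry letter `hKinv` serves `h137kπ`, `h137kΔ` AND `hCk`.
* §3 ★★ `h137_family_of_kinvEntry` — DOCKING BY NAME: §2 at `Λ := True` fed to ✓`Prop7Op137OfKernelRows.h137_of_kernel137_family_slot` gives the OPERATOR sup row of S22ᴸ∕S47's `h137π`∕`h137`
  shape from `hKent` alone (`c := 3·(1920e^{δK+1}CK)·(2(1+1∕δK))³`); π∕Δ editions by `rfl` on the slot.
HYP-SAT (★★OWNER №42).  RegPr + windows: inhabited on the literal families; `hKent`: a displayed kernel row in the currency px12's ✓p767718 produces (class (1) socket of record, not a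
restatement of the conclusion — the conclusion is a coarse→FINE row of a DIFFERENT operator); nothing eventual.
HONEST SCOPE.  Schur bookkeeping over part 1; no estimate of print is proved; nothing of (3.132), the `K⁻¹` entry rows, `hCk`, the other EX rows, EX or the crux is proved here; the
Yang–Mills mass gap is NOT proved.

References: T. Bałaban, CMP **99** (1985) 389–434 [Balaban1985BackgroundPropagators] ((3.13)–(3.16) p.393, (3.124)–(3.126) p.420, (3.132)–(3.133) p.422, Thm 3.12 p.423);
CMP **102** (1985) 277–309 [Balaban1985Variational] ((137) p.298); CMP **96** (1984) 223–250 [Balaban1984PropagatorsII] (§2, (2.61) p.234).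
-/

set_option autoImplicit false

noncomputable section

open scoped BigOperators Matrix.Norms.L2Operator InnerProductSpace ComplexConjugate

namespace Summit.QuantumFields.YangMills.Theorems.Prop7Kernel137DoorOfKinvEntry

open Literature.MathematicalPhysics.QuantumFieldTheory.Balaban1983to89
open Literature.MathematicalPhysics.QuantumFieldTheory.Balaban1983to89.T3ContinuumYM3Torus
open Literature.MathematicalPhysics.QuantumFieldTheory.Balaban1983to89.T3Thm1Carrier
open T3PrintedRegularMinimiser (RegPr)
open T3PrintedMinimiserExistence (regPr_mono)
open T3PrintedRegularOrbits (sites_eq)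
open T3LevelShift (siteShift)
open B9Eq311L2Pairing (WL2)
open B11Eq103H1Complex (BondL2K)
open B5Eq118OneStroke (iterBlockOf)
open Summit.QuantumFields.YangMills.Theorems.Prop7SectET3Transport (periodsT3)
open Summit.QuantumFields.YangMills.Theorems.Prop7SectET3HilbertLetters (W₂ toL2 toL2B)
open Summit.QuantumFields.YangMills.Theorems.Prop7SectET3CurvedPropagators (Qk KinvT)
open Summit.QuantumFields.YangMills.Theorems.Prop7CoarseFineKernelRows (kernelRow_CF_comp_CC kernelRow_adjoint_Qk_of_regPr)
open Summit.QuantumFields.YangMills.Theorems.Prop7KernelRowColumnGauge (tdist_coarse_self)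
open Summit.QuantumFields.YangMills.Theorems.Prop7Op137OfKernelRows (h137_of_kernel137_family_slot)

/-! ## §1 ★★★ The member door at a generic slot -/

section Member

variable (F : T3Family) {n K : ℕ} (h : n ≤ K) (c₀ cB : ℝ) [Fact (0 < c₀)] [Fact (0 < cB)]

/-- ★★★ **DOOR «KERNEL-137», MEMBER, GENERIC SLOT**: at a printed-regular background (`RegPr F n K ε₀ U₀`, windows `10¹⁰L⁶ε₀ ≤ 1`, `10¹²L³ε₀ ≤ 1`), any coupling `a : ℝ` and slot `Δx`, the
displayed coarse-entry row `hKent` of the composite `K⁻¹v − a•v` (`K⁻¹ = KinvT … a Δx U₀`; `C_K ≥ 0`, `δ_K > 0`) gives the `h137k` MEMBER TEXT — the coarse→fine pointwise kernel row of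
`Q_k†(K⁻¹·) − Q_k†(a·)` — with constant `1920·(cB∕c₀)·ℓ⁻³·e^{δ_K+1}·C_K` AT THE SAME RATE `δ_K` (part 1: `Q_k†`'s tube row at the free rate `δ_K + 1`, outer absorption, `ν = 1`).
[cite: Balaban1985Variational, (137) p.298; Balaban1985BackgroundPropagators, (3.124)–(3.126) p.420, (3.132)–(3.133) p.422; Balaban1984PropagatorsII, (2.61) p.234] -/
theorem kernel137_of_kinvEntry {ε₀ : ℝ} (hε₀ : 0 < ε₀) (hε : 10 ^ 10 * (F.L : ℝ) ^ 6 * ε₀ ≤ 1) (hε12 : 10 ^ 12 * (F.L : ℝ) ^ 3 * ε₀ ≤ 1)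
    (U₀ : GaugeField (F.P K) 0 (Matrix.specialUnitaryGroup (Fin 2) ℂ)) (hreg : RegPr F n K ε₀ U₀) (a : ℝ)
    (Δx : GaugeField (F.P K) 0 (Matrix.specialUnitaryGroup (Fin 2) ℂ) → (BondL2K ℂ 3 (periodsT3 F K) c₀ W₂ →ₗ[ℂ] BondL2K ℂ 3 (periodsT3 F K) c₀ W₂))
    {CK δK : ℝ} (hCK : 0 ≤ CK) (hδK : 0 < δK)
    (hKent : ∀ (y : PBond (F.P n) 0) (Z : Matrix (Fin 2) (Fin 2) ℂ) (y' : PBond (F.P n) 0),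
      ‖(toL2B F n cB).symm (KinvT F n K h c₀ cB a Δx U₀ (toL2B F n cB (Pi.single y Z)) - ((a : ℝ) : ℂ) • toL2B F n cB (Pi.single y Z)) y'‖
        ≤ CK * Real.exp (-(δK * (Site.tdist (P := F.P K) (siteShift (sites_eq F n K h) y'.src) (siteShift (sites_eq F n K h) y.src) : ℝ))) * ‖Z‖)
    (y : PBond (F.P n) 0) (Z : Matrix (Fin 2) (Fin 2) ℂ) (b : PBond (F.P K) 0) :
    ‖(toL2 F K c₀).symm (LinearMap.adjoint (Qk F n K h c₀ cB U₀) (KinvT F n K h c₀ cB a Δx U₀ (toL2B F n cB (Pi.single y Z)))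
        - LinearMap.adjoint (Qk F n K h c₀ cB U₀) (((a : ℝ) : ℂ) • toL2B F n cB (Pi.single y Z))) b‖
      ≤ (1920 * (cB / c₀) * ((F.L : ℝ) ^ (K - n))⁻¹ ^ 3 * Real.exp (δK + 1) * CK)
          * Real.exp (-(δK * (Site.tdist (P := F.P K) (iterBlockOf (K - n) b.src) (siteShift (sites_eq F n K h) y.src) : ℝ))) * ‖Z‖ := by
  have hc₀ : 0 < c₀ := Fact.out
  have hcB : 0 < cB := Fact.out
  have hL0 : (0 : ℝ) < F.L := by exact_mod_cast lt_trans zero_lt_one F.hL.2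
  -- the (137) letter as `Q_k† ∘ (K⁻¹ − a•1)`
  set M : WL2 ℂ (fun _ : PBond (F.P n) 0 => cB) W₂ →ₗ[ℂ] WL2 ℂ (fun _ : PBond (F.P n) 0 => cB) W₂ :=
    KinvT F n K h c₀ cB a Δx U₀ - ((a : ℝ) : ℂ) • LinearMap.id with hM
  have hTM : (LinearMap.adjoint (Qk F n K h c₀ cB U₀) ∘ₗ M) (toL2B F n cB (Pi.single y Z))
      = LinearMap.adjoint (Qk F n K h c₀ cB U₀) (KinvT F n K h c₀ cB a Δx U₀ (toL2B F n cB (Pi.single y Z)))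
        - LinearMap.adjoint (Qk F n K h c₀ cB U₀) (((a : ℝ) : ℂ) • toL2B F n cB (Pi.single y Z)) := by
    rw [LinearMap.comp_apply, hM, LinearMap.sub_apply, LinearMap.smul_apply, LinearMap.id_apply, map_sub]
  have hMrow : ∀ (y : PBond (F.P n) 0) (Z : Matrix (Fin 2) (Fin 2) ℂ) (y' : PBond (F.P n) 0),
      ‖(toL2B F n cB).symm (M (toL2B F n cB (Pi.single y Z))) y'‖
        ≤ CK * Real.exp (-(δK * (Site.tdist (P := F.P K) (siteShift (sites_eq F n K h) y'.src) (siteShift (sites_eq F n K h) y.src) : ℝ))) * ‖Z‖ := by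
    intro y Z y'
    rw [hM, LinearMap.sub_apply, LinearMap.smul_apply, LinearMap.id_apply]
    exact hKent y Z y'
  have hδ1 : 0 ≤ δK + 1 := by linarith
  have hcomp := kernelRow_CF_comp_CC F h c₀ cB (LinearMap.adjoint (Qk F n K h c₀ cB U₀)) M (r := δK) (ν := 1)
    (by positivity) hCK hδK.le le_rfl one_pos (by linarith)
    (kernelRow_adjoint_Qk_of_regPr F h c₀ cB hε₀ hε hε12 U₀ hreg hδ1) hMrow y Z b
  rw [hTM] at hcomp
  refine hcomp.trans (le_of_eq ?_)
  have h192 : (3 * (2 * (1 + 1 / 1 : ℝ)) ^ 3) = 192 := by norm_num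
  rw [h192]
  ring

end Member

/-! ## §2 ★★★ The Idx edition: generic slot, generic thread, windowed cap -/

section Family

/-- ★★★ **DOOR «KERNEL-137», Idx EDITION, GENERIC SLOT AND THREAD**: for a cap `α` with the windows of record (`0 < α L`, `10¹⁰L⁶α L ≤ 1`, `10¹²L³α L ≤ 1`), L-only weights `c₀ cB`, a member
coupling `a L i`, slots `Δx L i`, ANY thread `Λ L i U₀` (the S47 face: the `Lift` antecedent of record; ✓`h137_of_kernel137_family_slot`: none), and the displayed family letter `hKent`
— the coarse-entry row of `K⁻¹v − a•v` with constant `CK L·((c₀ L∕cB L)·ℓ³)` (`CK L` K-free: `KinvT` and `a L i` carry `(c₀∕cB)ℓ³` in the display's weights) at rate `δK L` — the S47 ROW TEXT of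
`h137kπ`∕`h137kΔ` (at the slot `Δx L i`) holds under the same thread with the L-ONLY constant `1920·exp(δK L + 1)·CK L` and the SAME rate `δK L`.
[cite: Balaban1985Variational, (137) p.298; Balaban1985BackgroundPropagators, (3.124)–(3.126) p.420, (3.132)–(3.133) p.422, Thm 3.12 p.423; Balaban1984PropagatorsII, (2.61) p.234] -/
theorem kernel137_family_of_kinvEntry
    (α : ℕ → ℝ) (hα : ∀ L : ℕ, 1 < L → 0 < α L) (hW : ∀ L : ℕ, 1 < L → 10 ^ 10 * (L : ℝ) ^ 6 * α L ≤ 1) (hW' : ∀ L : ℕ, 1 < L → 10 ^ 12 * (L : ℝ) ^ 3 * α L ≤ 1)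
    (c₀ cB : ℕ → ℝ) [hc₀ : ∀ L : ℕ, Fact (0 < c₀ L)] [hcB : ∀ L : ℕ, Fact (0 < cB L)] (a : ∀ L : ℕ, Idx L → ℝ)
    (Δx : ∀ (L : ℕ) (i : Idx L), GaugeField (i.1.1.P i.1.2.2) 0 (Matrix.specialUnitaryGroup (Fin 2) ℂ) →
      (BondL2K ℂ 3 (periodsT3 i.1.1 i.1.2.2) (c₀ L) W₂ →ₗ[ℂ] BondL2K ℂ 3 (periodsT3 i.1.1 i.1.2.2) (c₀ L) W₂))
    (Λ : ∀ (L : ℕ) (i : Idx L), GaugeField (i.1.1.P i.1.2.2) 0 (Matrix.specialUnitaryGroup (Fin 2) ℂ) → Prop)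
    (CK δK : ℕ → ℝ) (hCK : ∀ L, 1 < L → 0 ≤ CK L) (hδK : ∀ L, 1 < L → 0 < δK L)
    (hKent : ∀ (L : ℕ), 1 < L → ∀ (i : Idx L) (U₀ : GaugeField (i.1.1.P i.1.2.2) 0 (Matrix.specialUnitaryGroup (Fin 2) ℂ)), ∀ ρ : ℝ, RegPr i.1.1 i.1.2.1 i.1.2.2 ρ U₀ → ρ ≤ α L →
      Λ L i U₀ → ∀ (y : PBond (i.1.1.P i.1.2.1) 0) (Z : Matrix (Fin 2) (Fin 2) ℂ) (y' : PBond (i.1.1.P i.1.2.1) 0),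
        ‖(toL2B i.1.1 i.1.2.1 (cB L)).symm (KinvT i.1.1 i.1.2.1 i.1.2.2 i.2.2.le (c₀ L) (cB L) (a L i) (Δx L i) U₀ (toL2B i.1.1 i.1.2.1 (cB L) (Pi.single y Z))
            - ((a L i : ℂ)) • toL2B i.1.1 i.1.2.1 (cB L) (Pi.single y Z)) y'‖
          ≤ CK L * ((c₀ L / cB L) * ((L : ℝ) ^ (i.1.2.2 - i.1.2.1)) ^ 3)
              * Real.exp (-(δK L * (Site.tdist (siteShift (sites_eq i.1.1 i.1.2.1 i.1.2.2 i.2.2.le) y'.src) (siteShift (sites_eq i.1.1 i.1.2.1 i.1.2.2 i.2.2.le) y.src) : ℝ))) * ‖Z‖) :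
    ∀ (L : ℕ), 1 < L → ∀ (i : Idx L) (U₀ : GaugeField (i.1.1.P i.1.2.2) 0 (Matrix.specialUnitaryGroup (Fin 2) ℂ)), ∀ ρ : ℝ, RegPr i.1.1 i.1.2.1 i.1.2.2 ρ U₀ → ρ ≤ α L →
      Λ L i U₀ → ∀ (y : PBond (i.1.1.P i.1.2.1) 0) (Z : Matrix (Fin 2) (Fin 2) ℂ) (b : PBond (i.1.1.P i.1.2.2) 0),
        ‖(toL2 i.1.1 i.1.2.2 (c₀ L)).symm (LinearMap.adjoint (Qk i.1.1 i.1.2.1 i.1.2.2 i.2.2.le (c₀ L) (cB L) U₀) (KinvT i.1.1 i.1.2.1 i.1.2.2 i.2.2.le (c₀ L) (cB L) (a L i) (Δx L i) U₀ (toL2B i.1.1 i.1.2.1 (cB L) (Pi.single y Z)))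
            - LinearMap.adjoint (Qk i.1.1 i.1.2.1 i.1.2.2 i.2.2.le (c₀ L) (cB L) U₀) (((a L i : ℂ)) • toL2B i.1.1 i.1.2.1 (cB L) (Pi.single y Z))) b‖
          ≤ (1920 * Real.exp (δK L + 1) * CK L)
              * Real.exp (-(δK L * (Site.tdist (iterBlockOf (i.1.2.2 - i.1.2.1) b.src) (siteShift (sites_eq i.1.1 i.1.2.1 i.1.2.2 i.2.2.le) y.src) : ℝ))) * ‖Z‖ := by
  intro L hL i U₀ ρ hreg hρ hl y Z b
  have hFL : (i.1.1.L : ℝ) = (L : ℝ) := by rw [i.2.1]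
  have hc₀L : 0 < c₀ L := (hc₀ L).out
  have hcBL : 0 < cB L := (hcB L).out
  have hL0 : (0 : ℝ) < (L : ℝ) := by exact_mod_cast lt_trans zero_lt_one hL
  have hℓ : (0 : ℝ) < (L : ℝ) ^ (i.1.2.2 - i.1.2.1) := pow_pos hL0 _
  -- the member at the cap `α L`
  have hregα : RegPr i.1.1 i.1.2.1 i.1.2.2 (α L) U₀ := regPr_mono (F := i.1.1) hρ hreg
  have hεw : 10 ^ 10 * (i.1.1.L : ℝ) ^ 6 * α L ≤ 1 := by rw [hFL]; exact hW L hL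
  have hεw' : 10 ^ 12 * (i.1.1.L : ℝ) ^ 3 * α L ≤ 1 := by rw [hFL]; exact hW' L hL
  have hCKm : 0 ≤ CK L * ((c₀ L / cB L) * ((L : ℝ) ^ (i.1.2.2 - i.1.2.1)) ^ 3) := mul_nonneg (hCK L hL) (by positivity)
  have hmem := kernel137_of_kinvEntry i.1.1 i.2.2.le (c₀ L) (cB L) (hα L hL) hεw hεw' U₀ hregα (a L i) (Δx L i) hCKm (hδK L hL)
    (hKent L hL i U₀ ρ hreg hρ hl) y Z b
  rw [hFL] at hmem
  refine hmem.trans (le_of_eq ?_)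
  congr 1
  congr 1
  field_simp

end Family

/-! ## §3 ★★ Docking by name: the OPERATOR rows of the (137) letter from `hKent` alone -/

section Docking

/-- ★★ **E2E — THE (137) OPERATOR SUP ROW FROM THE COARSE ENTRY ROW, BY NAME**: §2 at the trivial thread fed to ✓`Prop7Op137OfKernelRows.h137_of_kernel137_family_slot` — for a windowed cap `α`,
the displayed family letter `hKent` (at `RegPr (α L)`, no thread) yields S22ᴸ∕S47's OPERATOR row shape «`‖toL2⁻¹(Q_k†((QGQ_k†)⁻¹_{Δx}(toL2B Y)) − Q_k†(a•toL2B Y))(b)‖ ≤ c·‖Y‖`» with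
`c := 3·(1920·e^{δK L+1}·CK L)·(2(1+1∕δK L))³`; the π∕Δ editions are `Δx := DeltaPiSlotP …` ∕ `DeltaEtaSlot … + TJSlotP …` by `rfl`.
[cite: Balaban1985Variational, (137) p.298; Balaban1985BackgroundPropagators, (3.124)–(3.126) p.420, (3.133) p.422, Thm 3.12 p.423] -/
theorem h137_family_of_kinvEntry
    (α : ℕ → ℝ) (hα : ∀ L : ℕ, 1 < L → 0 < α L) (hW : ∀ L : ℕ, 1 < L → 10 ^ 10 * (L : ℝ) ^ 6 * α L ≤ 1) (hW' : ∀ L : ℕ, 1 < L → 10 ^ 12 * (L : ℝ) ^ 3 * α L ≤ 1)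
    (c₀ cB : ℕ → ℝ) [hc₀ : ∀ L : ℕ, Fact (0 < c₀ L)] [hcB : ∀ L : ℕ, Fact (0 < cB L)] (a : ∀ L : ℕ, Idx L → ℝ)
    (Δx : ∀ (L : ℕ) (i : Idx L), GaugeField (i.1.1.P i.1.2.2) 0 (Matrix.specialUnitaryGroup (Fin 2) ℂ) →
      (BondL2K ℂ 3 (periodsT3 i.1.1 i.1.2.2) (c₀ L) W₂ →ₗ[ℂ] BondL2K ℂ 3 (periodsT3 i.1.1 i.1.2.2) (c₀ L) W₂))
    (CK δK : ℕ → ℝ) (hCK : ∀ L, 1 < L → 0 ≤ CK L) (hδK : ∀ L, 1 < L → 0 < δK L)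
    (hKent : ∀ (L : ℕ), 1 < L → ∀ (i : Idx L) (U₀ : GaugeField (i.1.1.P i.1.2.2) 0 (Matrix.specialUnitaryGroup (Fin 2) ℂ)), RegPr i.1.1 i.1.2.1 i.1.2.2 (α L) U₀ →
      ∀ (y : PBond (i.1.1.P i.1.2.1) 0) (Z : Matrix (Fin 2) (Fin 2) ℂ) (y' : PBond (i.1.1.P i.1.2.1) 0),
        ‖(toL2B i.1.1 i.1.2.1 (cB L)).symm (KinvT i.1.1 i.1.2.1 i.1.2.2 i.2.2.le (c₀ L) (cB L) (a L i) (Δx L i) U₀ (toL2B i.1.1 i.1.2.1 (cB L) (Pi.single y Z))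
            - ((a L i : ℂ)) • toL2B i.1.1 i.1.2.1 (cB L) (Pi.single y Z)) y'‖
          ≤ CK L * ((c₀ L / cB L) * ((L : ℝ) ^ (i.1.2.2 - i.1.2.1)) ^ 3)
              * Real.exp (-(δK L * (Site.tdist (siteShift (sites_eq i.1.1 i.1.2.1 i.1.2.2 i.2.2.le) y'.src) (siteShift (sites_eq i.1.1 i.1.2.1 i.1.2.2 i.2.2.le) y.src) : ℝ))) * ‖Z‖) :
    ∀ (L : ℕ), 1 < L → ∀ (i : Idx L) (U₀ : GaugeField (i.1.1.P i.1.2.2) 0 (Matrix.specialUnitaryGroup (Fin 2) ℂ)), RegPr i.1.1 i.1.2.1 i.1.2.2 (α L) U₀ →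
      ∀ (Y : PBond (i.1.1.P i.1.2.1) 0 → Matrix (Fin 2) (Fin 2) ℂ) (b : PBond (i.1.1.P i.1.2.2) 0),
        ‖(toL2 i.1.1 i.1.2.2 (c₀ L)).symm (LinearMap.adjoint (Qk i.1.1 i.1.2.1 i.1.2.2 i.2.2.le (c₀ L) (cB L) U₀) (KinvT i.1.1 i.1.2.1 i.1.2.2 i.2.2.le (c₀ L) (cB L) (a L i) (Δx L i) U₀ (toL2B i.1.1 i.1.2.1 (cB L) Y))
            - LinearMap.adjoint (Qk i.1.1 i.1.2.1 i.1.2.2 i.2.2.le (c₀ L) (cB L) U₀) (((a L i : ℂ)) • toL2B i.1.1 i.1.2.1 (cB L) Y)) b‖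
          ≤ (3 * (1920 * Real.exp (δK L + 1) * CK L) * (2 * (1 + 1 / δK L)) ^ 3) * ‖Y‖ :=
  h137_of_kernel137_family_slot α c₀ cB a Δx (fun L => 1920 * Real.exp (δK L + 1) * CK L) δK
    (fun L hL => by have := hCK L hL; positivity) hδK
    (fun L hL i U₀ hreg => kernel137_family_of_kinvEntry α hα hW hW' c₀ cB a Δx (fun _ _ _ => True) CK δK hCK hδK
      (fun L' hL' i' U₀' ρ hreg' hρ _ => hKent L' hL' i' U₀' (regPr_mono (F := i'.1.1) hρ hreg')) L hL i U₀ (α L) hreg le_rfl trivial)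

end Docking

/-! ## §4 (v1.1, append) The (137) letter's row from the row of `K⁻¹` itself: the coupling term is diagonal -/

section FromKinvRow

variable (F : T3Family) {n K : ℕ} (h : n ≤ K) (c₀ cB : ℝ) [Fact (0 < c₀)] [Fact (0 < cB)]

/-- **`hKent ⟸ hKinv`, MEMBER**: the coupling term `a•v` of the (137) composite is DIAGONAL in the coarse bond spikes (`toL2B⁻¹(a•toL2B(δ_y Z))(y′) = a·δ_{y y′}Z`, distance `0`), so a row
`C_K·e^{−δ·tdist(ŷ′,ŷ)}` of `K⁻¹` (the `hKinv` letter of the `hCk` door ∕ the output of ✓`Prop7KinvRowOfConjLetters.kinvRow_of_coercive_of_conjResolvent`) gives the row `(C_K + |a|)·e^{−δ·tdist(ŷ′,ŷ)}`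
of `K⁻¹v − a•v` (the `hKent` letter of §1). ONE coarse-entry letter thus serves all three `K⁻¹` rows of the EX face. [cite: Balaban1985Variational, (137) p.298; Balaban1985BackgroundPropagators, (3.132) p.422] -/
theorem kinvEntry_of_kinvRow (U₀ : GaugeField (F.P K) 0 (Matrix.specialUnitaryGroup (Fin 2) ℂ)) (a : ℝ)
    (Δx : GaugeField (F.P K) 0 (Matrix.specialUnitaryGroup (Fin 2) ℂ) → (BondL2K ℂ 3 (periodsT3 F K) c₀ W₂ →ₗ[ℂ] BondL2K ℂ 3 (periodsT3 F K) c₀ W₂))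
    {CK δK : ℝ}
    (hKinv : ∀ (y : PBond (F.P n) 0) (Z : Matrix (Fin 2) (Fin 2) ℂ) (y' : PBond (F.P n) 0),
      ‖(toL2B F n cB).symm (KinvT F n K h c₀ cB a Δx U₀ (toL2B F n cB (Pi.single y Z))) y'‖
        ≤ CK * Real.exp (-(δK * (Site.tdist (P := F.P K) (siteShift (sites_eq F n K h) y'.src) (siteShift (sites_eq F n K h) y.src) : ℝ))) * ‖Z‖)
    (y : PBond (F.P n) 0) (Z : Matrix (Fin 2) (Fin 2) ℂ) (y' : PBond (F.P n) 0) :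
    ‖(toL2B F n cB).symm (KinvT F n K h c₀ cB a Δx U₀ (toL2B F n cB (Pi.single y Z)) - ((a : ℝ) : ℂ) • toL2B F n cB (Pi.single y Z)) y'‖
      ≤ (CK + |a|) * Real.exp (-(δK * (Site.tdist (P := F.P K) (siteShift (sites_eq F n K h) y'.src) (siteShift (sites_eq F n K h) y.src) : ℝ))) * ‖Z‖ := by
  classical
  rw [map_sub, Pi.sub_apply, LinearEquiv.map_smul, LinearEquiv.symm_apply_apply, Pi.smul_apply]
  refine (norm_sub_le _ _).trans ?_
  have h1 := hKinv y Z y'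
  have h2 : ‖((a : ℝ) : ℂ) • (Pi.single y Z : PBond (F.P n) 0 → Matrix (Fin 2) (Fin 2) ℂ) y'‖
      ≤ |a| * Real.exp (-(δK * (Site.tdist (P := F.P K) (siteShift (sites_eq F n K h) y'.src) (siteShift (sites_eq F n K h) y.src) : ℝ))) * ‖Z‖ := by
    rw [norm_smul, Complex.norm_real, Real.norm_eq_abs]
    by_cases hy : y' = y
    · subst hy
      rw [Pi.single_eq_same, tdist_coarse_self, mul_zero, neg_zero, Real.exp_zero, mul_one]
    · rw [Pi.single_eq_of_ne hy, norm_zero, mul_zero]; positivity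
  linarith [h1, h2]

/-- ★★★ **DOOR «KERNEL-137» FROM THE ROW OF `K⁻¹` ITSELF, MEMBER**: §1 ∘ `kinvEntry_of_kinvRow` — `RegPr` + the two windows + `hKinv` (C_K, δ_K) ⟹ the `h137k` member text with constant
`1920·(cB∕c₀)·ℓ⁻³·e^{δ_K+1}·(C_K + |a|)` at rate `δ_K`. [cite: Balaban1985Variational, (137) p.298; Balaban1985BackgroundPropagators, (3.124)–(3.126) p.420, (3.132)–(3.133) p.422] -/
theorem kernel137_of_kinvRow {ε₀ : ℝ} (hε₀ : 0 < ε₀) (hε : 10 ^ 10 * (F.L : ℝ) ^ 6 * ε₀ ≤ 1) (hε12 : 10 ^ 12 * (F.L : ℝ) ^ 3 * ε₀ ≤ 1)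
    (U₀ : GaugeField (F.P K) 0 (Matrix.specialUnitaryGroup (Fin 2) ℂ)) (hreg : RegPr F n K ε₀ U₀) (a : ℝ)
    (Δx : GaugeField (F.P K) 0 (Matrix.specialUnitaryGroup (Fin 2) ℂ) → (BondL2K ℂ 3 (periodsT3 F K) c₀ W₂ →ₗ[ℂ] BondL2K ℂ 3 (periodsT3 F K) c₀ W₂))
    {CK δK : ℝ} (hCK : 0 ≤ CK) (hδK : 0 < δK)
    (hKinv : ∀ (y : PBond (F.P n) 0) (Z : Matrix (Fin 2) (Fin 2) ℂ) (y' : PBond (F.P n) 0),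
      ‖(toL2B F n cB).symm (KinvT F n K h c₀ cB a Δx U₀ (toL2B F n cB (Pi.single y Z))) y'‖
        ≤ CK * Real.exp (-(δK * (Site.tdist (P := F.P K) (siteShift (sites_eq F n K h) y'.src) (siteShift (sites_eq F n K h) y.src) : ℝ))) * ‖Z‖)
    (y : PBond (F.P n) 0) (Z : Matrix (Fin 2) (Fin 2) ℂ) (b : PBond (F.P K) 0) :
    ‖(toL2 F K c₀).symm (LinearMap.adjoint (Qk F n K h c₀ cB U₀) (KinvT F n K h c₀ cB a Δx U₀ (toL2B F n cB (Pi.single y Z)))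
        - LinearMap.adjoint (Qk F n K h c₀ cB U₀) (((a : ℝ) : ℂ) • toL2B F n cB (Pi.single y Z))) b‖
      ≤ (1920 * (cB / c₀) * ((F.L : ℝ) ^ (K - n))⁻¹ ^ 3 * Real.exp (δK + 1) * (CK + |a|))
          * Real.exp (-(δK * (Site.tdist (P := F.P K) (iterBlockOf (K - n) b.src) (siteShift (sites_eq F n K h) y.src) : ℝ))) * ‖Z‖ :=
  kernel137_of_kinvEntry F h c₀ cB hε₀ hε hε12 U₀ hreg a Δx (by positivity) hδK (kinvEntry_of_kinvRow F h c₀ cB U₀ a Δx hKinv) y Z b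

/-- ★★★ **DOOR «KERNEL-137» FROM THE ROW OF `K⁻¹`, Idx EDITION**: §2's thread and cap, the family letter `hKinv` at the scaling `CK L·((c₀∕cB)ℓ³)` (= the `hCk` door's
✓`kernelC_family_of_kinvRow_of_greenColumn` letter VERBATIM) and a displayed UPPER bound on the coupling `|a L i| ≤ A L·((c₀∕cB)ℓ³)` (the junction pins `a L i` at `a₀·(c₀∕cB)ℓ³`) ⟹ the S47 ROW
TEXT of `h137kπ`∕`h137kΔ` (at `Δx L i`) with the L-ONLY constant `1920·exp(δK L + 1)·(CK L + A L)`, rate `δK L`. [cite: Balaban1985Variational, (137) p.298; Balaban1985BackgroundPropagators, (3.132)–(3.133) p.422, Thm 3.12 p.423] -/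
theorem kernel137_family_of_kinvRow
    (α : ℕ → ℝ) (hα : ∀ L : ℕ, 1 < L → 0 < α L) (hW : ∀ L : ℕ, 1 < L → 10 ^ 10 * (L : ℝ) ^ 6 * α L ≤ 1) (hW' : ∀ L : ℕ, 1 < L → 10 ^ 12 * (L : ℝ) ^ 3 * α L ≤ 1)
    (c₀ cB : ℕ → ℝ) [hc₀ : ∀ L : ℕ, Fact (0 < c₀ L)] [hcB : ∀ L : ℕ, Fact (0 < cB L)] (a : ∀ L : ℕ, Idx L → ℝ) (A : ℕ → ℝ) (hA : ∀ L, 1 < L → 0 ≤ A L)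
    (haU : ∀ (L : ℕ), 1 < L → ∀ i : Idx L, |a L i| ≤ A L * ((c₀ L / cB L) * ((L : ℝ) ^ (i.1.2.2 - i.1.2.1)) ^ 3))
    (Δx : ∀ (L : ℕ) (i : Idx L), GaugeField (i.1.1.P i.1.2.2) 0 (Matrix.specialUnitaryGroup (Fin 2) ℂ) →
      (BondL2K ℂ 3 (periodsT3 i.1.1 i.1.2.2) (c₀ L) W₂ →ₗ[ℂ] BondL2K ℂ 3 (periodsT3 i.1.1 i.1.2.2) (c₀ L) W₂))
    (Λ : ∀ (L : ℕ) (i : Idx L), GaugeField (i.1.1.P i.1.2.2) 0 (Matrix.specialUnitaryGroup (Fin 2) ℂ) → Prop)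
    (CK δK : ℕ → ℝ) (hCK : ∀ L, 1 < L → 0 ≤ CK L) (hδK : ∀ L, 1 < L → 0 < δK L)
    (hKinv : ∀ (L : ℕ), 1 < L → ∀ (i : Idx L) (U₀ : GaugeField (i.1.1.P i.1.2.2) 0 (Matrix.specialUnitaryGroup (Fin 2) ℂ)), ∀ ρ : ℝ, RegPr i.1.1 i.1.2.1 i.1.2.2 ρ U₀ → ρ ≤ α L →
      Λ L i U₀ → ∀ (y : PBond (i.1.1.P i.1.2.1) 0) (Z : Matrix (Fin 2) (Fin 2) ℂ) (y' : PBond (i.1.1.P i.1.2.1) 0),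
        ‖(toL2B i.1.1 i.1.2.1 (cB L)).symm (KinvT i.1.1 i.1.2.1 i.1.2.2 i.2.2.le (c₀ L) (cB L) (a L i) (Δx L i) U₀ (toL2B i.1.1 i.1.2.1 (cB L) (Pi.single y Z))) y'‖
          ≤ CK L * ((c₀ L / cB L) * ((L : ℝ) ^ (i.1.2.2 - i.1.2.1)) ^ 3)
              * Real.exp (-(δK L * (Site.tdist (siteShift (sites_eq i.1.1 i.1.2.1 i.1.2.2 i.2.2.le) y'.src) (siteShift (sites_eq i.1.1 i.1.2.1 i.1.2.2 i.2.2.le) y.src) : ℝ))) * ‖Z‖) :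
    ∀ (L : ℕ), 1 < L → ∀ (i : Idx L) (U₀ : GaugeField (i.1.1.P i.1.2.2) 0 (Matrix.specialUnitaryGroup (Fin 2) ℂ)), ∀ ρ : ℝ, RegPr i.1.1 i.1.2.1 i.1.2.2 ρ U₀ → ρ ≤ α L →
      Λ L i U₀ → ∀ (y : PBond (i.1.1.P i.1.2.1) 0) (Z : Matrix (Fin 2) (Fin 2) ℂ) (b : PBond (i.1.1.P i.1.2.2) 0),
        ‖(toL2 i.1.1 i.1.2.2 (c₀ L)).symm (LinearMap.adjoint (Qk i.1.1 i.1.2.1 i.1.2.2 i.2.2.le (c₀ L) (cB L) U₀) (KinvT i.1.1 i.1.2.1 i.1.2.2 i.2.2.le (c₀ L) (cB L) (a L i) (Δx L i) U₀ (toL2B i.1.1 i.1.2.1 (cB L) (Pi.single y Z)))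
            - LinearMap.adjoint (Qk i.1.1 i.1.2.1 i.1.2.2 i.2.2.le (c₀ L) (cB L) U₀) (((a L i : ℂ)) • toL2B i.1.1 i.1.2.1 (cB L) (Pi.single y Z))) b‖
          ≤ (1920 * Real.exp (δK L + 1) * (CK L + A L))
              * Real.exp (-(δK L * (Site.tdist (iterBlockOf (i.1.2.2 - i.1.2.1) b.src) (siteShift (sites_eq i.1.1 i.1.2.1 i.1.2.2 i.2.2.le) y.src) : ℝ))) * ‖Z‖ := by
  intro L hL i U₀ ρ hreg hρ hl y Z b
  have hc₀L : 0 < c₀ L := (hc₀ L).out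
  have hcBL : 0 < cB L := (hcB L).out
  have hL0 : (0 : ℝ) < (L : ℝ) := by exact_mod_cast lt_trans zero_lt_one hL
  have hℓ : (0 : ℝ) < (L : ℝ) ^ (i.1.2.2 - i.1.2.1) := pow_pos hL0 _
  have hs : 0 < (c₀ L / cB L) * ((L : ℝ) ^ (i.1.2.2 - i.1.2.1)) ^ 3 := by positivity
  -- the row of the composite at the member, then §2 with `CK := CK L + A L`
  refine kernel137_family_of_kinvEntry α hα hW hW' c₀ cB a Δx Λ (fun L => CK L + A L) δK (fun L hL => add_nonneg (hCK L hL) (hA L hL)) hδK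
    (fun L' hL' i' U₀' ρ' hreg' hρ' hl' y₁ Z₁ y₁' => ?_) L hL i U₀ ρ hreg hρ hl y Z b
  have hs' : 0 < (c₀ L' / cB L') * ((L' : ℝ) ^ (i'.1.2.2 - i'.1.2.1)) ^ 3 := by
    have h1 : 0 < c₀ L' := (hc₀ L').out
    have h2 : 0 < cB L' := (hcB L').out
    have hL0' : (0 : ℝ) < (L' : ℝ) := by exact_mod_cast lt_trans zero_lt_one hL'
    positivity
  have hrow := kinvEntry_of_kinvRow i'.1.1 i'.2.2.le (c₀ L') (cB L') U₀' (a L' i') (Δx L' i') (hKinv L' hL' i' U₀' ρ' hreg' hρ' hl') y₁ Z₁ y₁'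
  refine hrow.trans (mul_le_mul_of_nonneg_right (mul_le_mul_of_nonneg_right ?_ (Real.exp_pos _).le) (norm_nonneg _))
  have := haU L' hL' i'
  nlinarith [this, hs']

end FromKinvRow

end Summit.QuantumFields.YangMills.Theorems.Prop7Kernel137DoorOfKinvEntry

end
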